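import Literature.Algebra.Homology.OrderedCechPairSystemLexComparison
import Literature.Algebra.Homology.OrderedCechPairSystemColumnCriterion
import Literature.Algebra.Homology.OrderedCechPairSystemBounds
import Literature.Algebra.Homology.TotalQuasiIsoOfBoundedColumns
import Literature.Algebra.Homology.BicomplexSingleColumn
import Literature.Algebra.Homology.FlatQuasiIsoBaseChange
import HarnessLib

/-!
# Column collapse of the ordered Čech bicomplex of a pair-system: if the columns `Č•(P(σ, ·))`, `#σ ≥ 2`, are exact then
# `Hⁿ(Č•(lexSystem P)) ≅ Hⁿ(column 0)` (Stacks 0133, 012Z; Weibel 5.6.2)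

Layer `Literature/Algebra/Homology` (proved lemmas only; 0 `def`, 0 named facts, no instance, no notation; pure homological algebra over a
commutative ring `A`).  For a pair-system `P : Finset ι ⥤ Finset κ ⥤ ModuleCat A` (finite linear orders `ι`, `κ`) the ordered Čech
bicomplex `Č•,•(P)` of ★ `Algebra/Homology/OrderedCechPairSystem` has OUTER term `a ↦ Č•(cochainSystem P a) = Π_{#σ = a+1} Č•(P(σ, ·))`.
This file proves the degenerate case of the column filtration spectral sequence that «cohomology and base change» uses ([MumfordAV1970] §8,
proof of Thm. 1; §13): when every column of outer degree `a ≥ 1` is exact, the total complex is quasi-isomorphic to column `0`.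

* §1 **`exactAt_sysBicomplex_X_iff`** — column `a` of `Č•,•(P)` is exact in degree `b` iff `Č•(P(σ, ·))` is exact in degree `b` for every
  `a`-simplex `σ` (the differentials act componentwise in `σ`, ★ `sysComplex_d_cochainSystem_apply`).
* §2 **`nonempty_homologyIso_total_X_zero`** — if the columns `a ≥ 1` are exact, `Hⁿ(Tot Č•,•(P)) ≅ Hⁿ(Č⁰'•(P))`: the projection
  `Č•,•(P) ⟶ (column 0)[0]` (Mathlib `HomologicalComplex.mkHomToSingle`) is a column-wise quasi-isomorphism of first-quadrant bicomplexes
  (★ `TotalQuasiIsoOfBoundedColumns.quasiIso_total_map_of_quasiIso_columns_of_isStrictlyGE`), and `Tot(X[0]) ≅ X`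
  (★ `BicomplexSingleColumn.ιTotalSingleColumnIso`).
* §3 the PRODUCT-COVER forms, through ★ `nonempty_homologyIso_total_lexSystem` (`Hⁿ(Tot Č•,•(P)) ≅ Hⁿ(Č•(lexSystem P))`):
  **`nonempty_homologyIso_lexSystem_column_zero`** (`Hⁿ(Č•(lexSystem P)) ≅ Hⁿ(Č⁰'•(P))` when `Č•(P(σ, ·))` is exact for `#σ ≥ 2`),
  **`exactAt_sysComplex_lexSystem_of_forall`** (all `Č•(P(σ, ·))`, `σ ≠ ∅`, exact ⇒ `Č•(lexSystem P)` exact — the «fibrewise acyclic ⇒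
  acyclic» step) and **`exactAt_sysComplex_obj_singleton_of_exactAt_lexSystem`** (columns `#σ ≥ 2` exact and `Č•(lexSystem P)` exact in
  degree `n` ⇒ every `Č•(P({i}, ·))` exact in degree `n` — the «support» step).

Consumer: cell `hodgecm-mathlib` (D-0151), DUAL-S road (A), «CBC cut» head (CBC-2) (B-p08 (g33) memo `MEMO-CBC-cut.v1`), geometric sequel
`AlgebraicGeometry/Modules/CechProductCoverColumnCollapse` (`P := boxSectionsSystem p q 𝓤 𝓥 G ρ`).  Library only (count-neutral); proves
nothing about any crux, route or conjecture; HC_CM is proved only modulo the printed citations until rung 0 closes.  Mathlib searched (pin):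
`HomologicalComplex.mkHomToSingle`, `mkHomToSingle_f`, `singleObjXSelf`, `isZero_single_obj_X`, `Limits.IsZero.isIso`,
`HomologicalComplex.exactAt_iff_isZero_homology`, `quasiIsoAt_iff_isIso_homologyMap`, `exactAt_iff_of_quasiIsoAt` (used); Mathlib has no Čech
complexes of systems of modules.

## References

* The Stacks Project, Tag 0133 (acyclic columns of a double complex), Tag 012Z (total complex), Tag 0BEC (the double Čech complex of two
  coverings). [StacksProject]
* C. A. Weibel, *An introduction to homological algebra* (1994), 5.6.1–5.6.2 (the two filtrations of a double complex), 1.2.6. [Weibel1994]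
* D. Mumford, *Abelian Varieties* (1970), §8 proof of Theorem 1 (p. 77), §13 (pp. 127–129) (the use: higher direct images supported on
  finitely many fibres). [MumfordAV1970]
-/

noncomputable section

-- `GradedObject`/`HomologicalComplex₂.toGradedObject` are not reducible (as in Mathlib's `Algebra/Homology/TotalComplex.lean`).
set_option backward.isDefEq.respectTransparency false

open CategoryTheory CategoryTheory.Limits HomologicalComplex

universe u

namespace Literature.Algebra.Homology

namespace OrderedCech

variable {A : Type u} [CommRing A] {ι κ : Type} [LinearOrder ι] [LinearOrder κ]
variable (P : Finset ι ⥤ Finset κ ⥤ ModuleCat.{u} A)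

/-! ### §1 Exactness of a column is checked simplex by simplex -/

/-- Elementwise exactness of a cochain complex of modules in degree `n`. [cite: Weibel1994, 1.2.6] -/
theorem exactAt_iff_forall_exists_eq (K : CochainComplex (ModuleCat.{u} A) ℤ) (n : ℤ) :
    K.ExactAt n ↔ ∀ x : K.X n, (K.d n (n + 1)).hom x = 0 → ∃ y : K.X (n - 1), (K.d (n - 1) n).hom y = x := by
  rw [exactAt_iff_function_exact K (n - 1) n (n + 1) (by omega) rfl]
  constructor
  · intro h x hx
    exact (h x).1 hx
  · intro h x
    refine ⟨h x, ?_⟩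
    rintro ⟨y, rfl⟩
    rw [← LinearMap.comp_apply, ← ModuleCat.hom_comp, K.d_comp_d, ModuleCat.hom_zero, LinearMap.zero_apply]

/-- **Column `a` of `Č•,•(P)` is exact in degree `b` iff `Č•(P(σ, ·))` is exact in degree `b` for every `a`-simplex `σ`** (the differentials of
`Č•(cochainSystem P a) = Π_σ Č•(P(σ, ·))` act componentwise in `σ`). [cite: StacksProject, Tag 0BEC] [cite: StacksProject, Tag 0133] -/
theorem exactAt_sysBicomplex_X_iff (a b : ℤ) :
    ((sysBicomplex P).X a).ExactAt b ↔ ∀ σ : Simplex ι a, (sysComplex (P.obj σ.1)).ExactAt b := by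
  classical
  rw [sysBicomplex_X, exactAt_iff_forall_exists_eq]
  constructor
  · intro h σ
    rw [exactAt_iff_forall_exists_eq]
    intro x hx
    -- extend `x` by zero to a cochain of `cochainSystem P a`
    let X : SysCochain (cochainSystem P a) b := fun τ => fun σ' => if hσ : σ' = σ then hσ ▸ x τ else 0
    have hX : ((sysComplex (cochainSystem P a)).d b (b + 1)).hom X = 0 := by
      funext τ'
      funext σ'
      rw [sysComplex_d_cochainSystem_apply]
      by_cases hσ : σ' = σ
      · subst hσ
        have : (fun τ : Simplex κ b => (X τ : SysCochain (P.flip.obj τ.1) a) σ') = x := by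
          funext τ; simp [X]
        rw [this, hx]; rfl
      · have : (fun τ : Simplex κ b => (X τ : SysCochain (P.flip.obj τ.1) a) σ') = 0 := by
          funext τ; simp [X, hσ]
        rw [this, map_zero]; rfl
    obtain ⟨Y, hY⟩ := h X hX
    refine ⟨fun τ => (Y τ : SysCochain (P.flip.obj τ.1) a) σ, ?_⟩
    funext τ
    have := congr_fun (congr_fun hY τ) σ
    rw [sysComplex_d_cochainSystem_apply] at this
    rw [this]
    simp [X]
  · intro h X hX
    have hc : ∀ σ : Simplex ι a, ∃ y : SysCochain (P.obj σ.1) (b - 1),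
        ((sysComplex (P.obj σ.1)).d (b - 1) b).hom y = fun τ => (X τ : SysCochain (P.flip.obj τ.1) a) σ := fun σ =>
      (exactAt_iff_forall_exists_eq _ _).1 (h σ) _ (funext fun τ' => by
        have := congr_fun (congr_fun hX τ') σ
        rw [sysComplex_d_cochainSystem_apply] at this
        exact this)
    choose y hy using hc
    refine ⟨fun τ σ => y σ τ, funext fun τ => funext fun σ => ?_⟩
    rw [sysComplex_d_cochainSystem_apply]
    exact congr_fun (hy σ) τ

/-- Columns from members: if `Č•(P(σ, ·))` is exact in every degree for every `σ` with `2 ≤ #σ`, then every column of `Č•,•(P)` of outer degree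
`a ≥ 1` is exact. [cite: StacksProject, Tag 0133] -/
theorem exactAt_sysBicomplex_X_of_two_le (hcol : ∀ σ : Finset ι, 2 ≤ σ.card → ∀ b : ℤ, (sysComplex (P.obj σ)).ExactAt b)
    (a : ℤ) (ha : 1 ≤ a) (b : ℤ) : ((sysBicomplex P).X a).ExactAt b :=
  (exactAt_sysBicomplex_X_iff P a b).2 fun σ => hcol σ.1 (by have := σ.2.2; omega) b

/-! ### §2 The projection onto column `0` and the collapse `Hⁿ(Tot Č•,•(P)) ≅ Hⁿ(Č⁰'•(P))` -/

/-- **Column collapse**: if the columns of `Č•,•(P)` of outer degree `a ≥ 1` are exact, then for every `n` the cohomology of the total complex is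
that of column `0`: `Hⁿ(Tot Č•,•(P)) ≅ Hⁿ(Č•(cochainSystem P 0))` — the projection `Č•,•(P) ⟶ (Č⁰'•(P))[0]` is a column-wise quasi-isomorphism of
first-quadrant bicomplexes, hence induces a quasi-isomorphism of total complexes, and `Tot(X[0]) ≅ X`.
[cite: StacksProject, Tag 0133] [cite: StacksProject, Tag 012Z] [cite: Weibel1994, 5.6.2] -/
theorem nonempty_homologyIso_total_X_zero (hcol : ∀ a : ℤ, 1 ≤ a → ∀ b : ℤ, ((sysBicomplex P).X a).ExactAt b) (n : ℤ) :
    Nonempty (((sysBicomplex P).total (ComplexShape.up ℤ)).homology n ≅ ((sysBicomplex P).X 0).homology n) := by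
  -- the projection onto the single-column bicomplex `(column 0)[0]`
  let π : sysBicomplex P ⟶ singleColumnBicomplex ((sysBicomplex P).X 0) :=
    mkHomToSingle (𝟙 ((sysBicomplex P).X 0)) fun i (hi : i + 1 = 0) =>
      (isZero_sysBicomplex_X_of_neg P i (by omega)).eq_of_src _ _
  -- column-wise quasi-isomorphism
  have hπ : ∀ p : ℤ, QuasiIso (π.f p) := by
    intro p
    by_cases hp : p = 0
    · subst hp
      have : π.f 0 = 𝟙 ((sysBicomplex P).X 0) ≫ (singleObjXSelf (ComplexShape.up ℤ) 0 ((sysBicomplex P).X 0)).inv :=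
        mkHomToSingle_f _ _
      rw [this, Category.id_comp]
      infer_instance
    · rw [quasiIso_iff]
      intro b
      rw [quasiIsoAt_iff_isIso_homologyMap]
      have hT : IsZero (((singleColumnBicomplex ((sysBicomplex P).X 0)).X p).homology b) :=
        (homologyFunctor _ _ b).map_isZero (isZero_singleColumnBicomplex_X _ p hp)
      have hS : IsZero (((sysBicomplex P).X p).homology b) := by
        rcases lt_or_gt_of_ne hp with hp' | hp'
        · exact (homologyFunctor _ _ b).map_isZero (isZero_sysBicomplex_X_of_neg P p hp')
        · exact (((sysBicomplex P).X p).exactAt_iff_isZero_homology b).1 (hcol p (by omega) b)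
      exact Limits.IsZero.isIso hS hT _
  -- first-quadrant bounds and the total quasi-isomorphism
  haveI := isStrictlyGE_sysBicomplex P
  haveI := isStrictlyGE_singleColumnBicomplex ((sysBicomplex P).X 0)
  haveI : CochainComplex.IsStrictlyGE ((sysBicomplex P).X 0) 0 := isStrictlyGE_sysBicomplex_X P 0
  haveI hq : QuasiIso (HomologicalComplex₂.total.map π (ComplexShape.up ℤ)) :=
    quasiIso_total_map_of_quasiIso_columns_of_isStrictlyGE _ _ π 0 0 (isStrictlyGE_sysBicomplex_X P)
      (fun p => isStrictlyGE_singleColumnBicomplex_X ((sysBicomplex P).X 0) 0 p) hπ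
  exact ⟨isoOfQuasiIsoAt (HomologicalComplex₂.total.map π (ComplexShape.up ℤ)) n ≪≫
    ((homologyFunctor _ _ n).mapIso (ιTotalSingleColumnIso ((sysBicomplex P).X 0))).symm⟩

/-! ### §3 Product-cover forms -/

/-- **`Hⁿ(Č•(lexSystem P)) ≅ Hⁿ(Č⁰'•(P))` when the members `Č•(P(σ, ·))`, `#σ ≥ 2`, are exact** (★ `nonempty_homologyIso_total_lexSystem` + §2).
[cite: StacksProject, Tag 0BEC] [cite: StacksProject, Tag 0133] -/
theorem nonempty_homologyIso_lexSystem_column_zero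
    (hcol : ∀ σ : Finset ι, 2 ≤ σ.card → ∀ b : ℤ, (sysComplex (P.obj σ)).ExactAt b) (n : ℤ) :
    Nonempty ((sysComplex (lexSystem P)).homology n ≅ ((sysBicomplex P).X 0).homology n) := by
  obtain ⟨e₁⟩ := nonempty_homologyIso_total_lexSystem P n
  obtain ⟨e₂⟩ := nonempty_homologyIso_total_X_zero P (exactAt_sysBicomplex_X_of_two_le P hcol) n
  exact ⟨e₁.symm ≪≫ e₂⟩

/-- **Fibrewise acyclic ⇒ acyclic**: if `Č•(P(σ, ·))` is exact in every degree for every non-empty `σ`, then `Č•(lexSystem P)` (the Čech complex of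
the product cover) is exact in every degree. [cite: StacksProject, Tag 0133] [cite: MumfordAV1970, §8 proof of Theorem 1 (p. 77)] -/
theorem exactAt_sysComplex_lexSystem_of_forall
    (hcol : ∀ σ : Finset ι, σ.Nonempty → ∀ b : ℤ, (sysComplex (P.obj σ)).ExactAt b) (n : ℤ) :
    (sysComplex (lexSystem P)).ExactAt n := by
  obtain ⟨e⟩ := nonempty_homologyIso_lexSystem_column_zero P (fun σ hσ b => hcol σ (Finset.card_pos.1 (by omega)) b) n
  rw [exactAt_iff_isZero_homology]
  refine IsZero.of_iso ?_ e
  rw [← exactAt_iff_isZero_homology, exactAt_sysBicomplex_X_iff]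
  exact fun σ => hcol σ.1 σ.2.1 n

/-- **Support step**: if `Č•(P(σ, ·))` is exact in every degree for `#σ ≥ 2` and `Č•(lexSystem P)` is exact in degree `n`, then `Č•(P({i}, ·))` is
exact in degree `n` for every `i` (column `0` is the product of the `Č•(P({i}, ·))`). [cite: StacksProject, Tag 0133]
[cite: MumfordAV1970, §8 proof of Theorem 1 (p. 77)] -/
theorem exactAt_sysComplex_obj_singleton_of_exactAt_lexSystem
    (hcol : ∀ σ : Finset ι, 2 ≤ σ.card → ∀ b : ℤ, (sysComplex (P.obj σ)).ExactAt b) (n : ℤ)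
    (hn : (sysComplex (lexSystem P)).ExactAt n) (i : ι) : (sysComplex (P.obj {i})).ExactAt n := by
  obtain ⟨e⟩ := nonempty_homologyIso_lexSystem_column_zero P hcol n
  have h0 : ((sysBicomplex P).X 0).ExactAt n := by
    rw [exactAt_iff_isZero_homology] at hn ⊢
    exact hn.of_iso e.symm
  exact (exactAt_sysBicomplex_X_iff P 0 n).1 h0 ⟨{i}, Finset.singleton_nonempty i, by simp⟩

end OrderedCech

end Literature.Algebra.Homology

end
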